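import Literature.Analysis.FluidPDE.PassiveVectorTensor
import Literature.Analysis.FluidPDE.FractionalNSPrescribedEnergyProlongationProofs
import HarnessLib

/-!
# K1L_D (stmt-AnomalousDissipation-27980), brick Z4♭ support: a weak tensor passive-vector solution on `[0,T)` is one on every shorter
# horizon `[0,T')`, `0 < T' ≤ T` (helper; `--supports … --as helper`; lead-k1l-onelevel-p1 g4)

`Torus.IsWeakTensorPassiveVectorOn A T 𝔸 b w₀ w → T' ≤ T → Torus.IsWeakTensorPassiveVectorOn A T' 𝔸 b w₀ w` (`mono_horizon`): the
bookkeeping clauses restrict to the sub-interval, and a space–time test for the horizon `T'` (smooth, vanishing from some `T'' < T'` on) is a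
test for `T`, the weak identity on `(0,T)` reducing to the one on `(0,T')` because the integrand vanishes where the test does (`Ψ t = 0`,
hence `∂ₜΨ t = 0`, `(b·∇)Ψ t = 0` (`Torus.convect_pi_zero_right`), `𝓛_𝔸^*Ψ t = 0`, `(w·∇)Ψ t = 0` for `t > T''`).  Needed by the flat core Z4♭ of the bilinear cut (memo L8 §2):
the slow-vector clause (V) compares a cell solution on `(0,T)` with an effective solution on `(0,2T)`, while the window orbits come on ONE horizon.
Generic dimension `d`.  NOT a proof of any registered stub, of the crux, or of AD; rung F-D1.A0.
-/

set_option linter.dupNamespace false  -- the summit-side namespace `Summit.AnomalousDissipation.AnomalousDissipation.…` repeats a component by design (D-0017)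

noncomputable section

namespace Summit.AnomalousDissipation.AnomalousDissipation.Theorems.SolenoidalFractalHomogenisation.LagrangianStep.WeakSol

open Literature.Analysis Literature.Analysis.FluidPDE Literature.Analysis.FluidPDE.Torus Literature.Analysis.FunctionSpaces
open MeasureTheory Set Filter Function
open scoped ENNReal NNReal InnerProductSpace

variable {d : Type*} [Fintype d] [DecidableEq d]

omit [Fintype d] [DecidableEq d] in
/-- A space–time test that vanishes from `T''` on has vanishing time derivative after `T''`. -/
theorem timeDeriv_eq_zero_of_eventually {F : Type*} [NormedAddCommGroup F] [NormedSpace ℝ F]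
    {Ψ : ℝ → UnitAddTorus d → F} {T'' t : ℝ} (h : ∀ s, T'' ≤ s → Ψ s = 0) (ht : T'' < t) (x : UnitAddTorus d) :
    FunctionSpaces.Torus.timeDeriv Ψ t x = 0 := by
  unfold FunctionSpaces.Torus.timeDeriv
  have hev : (fun τ => Ψ τ x) =ᶠ[nhds t] fun _ => (0 : F) := by
    filter_upwards [Ioi_mem_nhds ht] with τ hτ
    rw [h τ (le_of_lt hτ)]; rfl
  rw [hev.deriv_eq, deriv_const]

variable {A T T' : ℝ} {𝔸 : Visc4 d} {b w : ℝ → UnitAddTorus d → EuclideanSpace ℝ d} {w₀ : UnitAddTorus d → EuclideanSpace ℝ d}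

/-- **Restriction of the horizon.**  A weak solution on `[0,T)` is a weak solution on `[0,T')` for `T' ≤ T`. -/
theorem mono_horizon (h : IsWeakTensorPassiveVectorOn A T 𝔸 b w₀ w) (hT' : T' ≤ T) :
    IsWeakTensorPassiveVectorOn A T' 𝔸 b w₀ w where
  aestronglyMeasurable :=
    h.aestronglyMeasurable.mono_measure (Measure.restrict_mono (prod_mono (Ioo_subset_Ioo le_rfl hT') le_rfl) le_rfl)
  aestronglyMeasurable_carrier :=
    h.aestronglyMeasurable_carrier.mono_measure (Measure.restrict_mono (prod_mono (Ioo_subset_Ioo le_rfl hT') le_rfl) le_rfl)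
  ae_lintegral_sq_le := by
    obtain ⟨C, hC⟩ := h.ae_lintegral_sq_le
    exact ⟨C, ae_restrict_of_ae_restrict_of_subset (Ioo_subset_Ioo le_rfl hT') hC⟩
  lintegral_carrier_lt_top :=
    lt_of_le_of_lt (lintegral_mono_set (Ioo_subset_Ioo le_rfl hT')) h.lintegral_carrier_lt_top
  lintegral_mul_lt_top :=
    lt_of_le_of_lt (lintegral_mono_set (Ioo_subset_Ioo le_rfl hT')) h.lintegral_mul_lt_top
  ae_isWeaklyDivFree_carrier := ae_restrict_of_ae_restrict_of_subset (Ioo_subset_Ioo le_rfl hT') h.ae_isWeaklyDivFree_carrier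
  ae_isWeaklyDivFree := ae_restrict_of_ae_restrict_of_subset (Ioo_subset_Ioo le_rfl hT') h.ae_isWeaklyDivFree
  weak_eq := by
    intro Ψ hΨ hΨd
    obtain ⟨hsmooth, T'', hT''T', hvan⟩ := hΨ
    have hΨT : FunctionSpaces.Torus.IsSpaceTimeTest T Ψ := ⟨hsmooth, T'', lt_of_lt_of_le hT''T' hT', hvan⟩
    have key := h.weak_eq Ψ hΨT hΨd
    -- the integrand vanishes on `[T', T)`
    rw [setIntegral_eq_of_subset_of_forall_sdiff_eq_zero measurableSet_Ioo (Ioo_subset_Ioo le_rfl hT')] at key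
    · exact key
    · intro t ht
      have ht' : T'' < t := by
        have h1 : T' ≤ t := by
          by_contra hlt
          exact ht.2 ⟨ht.1.1, not_le.1 hlt⟩
        exact lt_of_lt_of_le hT''T' h1
      have hΨt : Ψ t = 0 := hvan t ht'.le
      have hint : ∀ x, (⟪w t x, FunctionSpaces.Torus.timeDeriv Ψ t x + FunctionSpaces.Torus.convect (b t) (Ψ t) x + viscAdj 𝔸 (Ψ t) x⟫_ℝ +
          A * ⟪b t x, FunctionSpaces.Torus.convect (w t) (Ψ t) x⟫_ℝ) = 0 := by
        intro x
        rw [timeDeriv_eq_zero_of_eventually hvan ht' x, hΨt, Torus.convect_pi_zero_right, Torus.convect_pi_zero_right, viscAdj_zero_field]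
        simp
      simp_rw [hint]
      exact integral_zero _ _

end Summit.AnomalousDissipation.AnomalousDissipation.Theorems.SolenoidalFractalHomogenisation.LagrangianStep.WeakSol

end
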